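import Summits.AtomisticToContinuum.FouriersLaw.Theorems.BondHeatUncertaintyExtensiveSnapshotIrreversibilityTapDualityOddCorrectorAux1
import Summits.AtomisticToContinuum.FouriersLaw.Theorems.BondHeatUncertaintyExtensiveSnapshotIrreversibilityClausiusBudgetKinetics
import Summits.AtomisticToContinuum.FouriersLaw.Theorems.JunctionLocalityNonBallisticStubColumnFlatGreenKuboAux2
import Summits.AtomisticToContinuum.FouriersLaw.Theorems.OddSectorIrreversibilityResponseDensityAssembly
import Summits.AtomisticToContinuum.FouriersLaw.Theorems.BondHeatUncertaintyLinearResponseFTURK3Setting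

/-!
# The odd transport forecast is bond-independent (structural identity of line `tap-duality-gk-time`,
crux `BondHeatUncertainty.ExtensiveSnapshotIrreversibility`, stmt-AtomisticToContinuum-9121)

Pinned anharmonic chain `P = pinnedChain ω₂ lam β γ` (all parameters `> 0`), both baths at `T > 0`,
equilibrium kernels `P_s = P.transitionKernel N T T s`.  For a bond `i` let
`F_i(z) := ∫₀^∞ P_s j_i (z) ds` be the forecast of the future energy transport through the bond
(an absolutely convergent improper integral: `j_i` is continuous, odd under the momentum flip and
`O(e^{ϑH})`, so its forecasts decay exponentially, `forecast_decay_of_odd`).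

* `forecastIntegral_bondCurrent_sub_eq` — for three consecutive sites `a, b, c` (bonds `a = (a,b)` and
  `b = (b,c)`): `F_a(z) − F_b(z) = μ_T(ẽ_b) − ẽ_b(z)` with the split site energy
  `ẽ_b = p_b²/2 + U(q_b) + ½V(q_c − q_b) + ½V(q_b − q_a)`: the future transport through bond `a` exceeds
  that through bond `b` by exactly the energy the interior site `b` will shed (Dynkin for `ẽ_b`,
  `L ẽ_b = j_a − j_b`, and mixing `P_r ẽ_b → μ_T(ẽ_b)`);
* `oddPart_forecastIntegral_bondCurrent_eq` — hence the ODD parts agree pointwise: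
  `F_a(z) − F_a(Θz) = F_b(z) − F_b(Θz)` (`ẽ_b` is flip-even).  In operator language
  (`Γ = ½((−L)⁻¹ + (−L†)⁻¹)`, `Γ j = (G j)_odd` for odd `j`): `Γ j_a = Γ j_b` for all interior bonds, so the
  odd Kubo corrector of the total current is `(N − 1)` copies of ONE bond's odd forecast,
  `uo = (N−1)·Γ j_b`, and the crux's `N`-uniform content `∫ uo² ≤ C N³` reads `‖Γ j_b‖² ≤ C·N` for a single
  bond.

References: Cuneo–Eckmann–Hairer–Rey-Bellet 2018 (kernels, (2.5), (3.4)); folklore.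
-/

noncomputable section

open MeasureTheory ProbabilityTheory Filter Topology Set Function
open scoped NNReal ENNReal ContDiff
open Literature.MathematicalPhysics.KineticTheory.HeatConduction
open Literature.MathematicalPhysics.KineticTheory OscillatorChain
open Summit.AtomisticToContinuum.FouriersLaw.Theorems.SubdiffusiveBondHeat
open Summit.AtomisticToContinuum.FouriersLaw.Theorems.OddSectorIrreversibility
open Summit.AtomisticToContinuum.FouriersLaw.Theorems.OddSectorIrreversibility.Corrector

namespace Summit.AtomisticToContinuum.FouriersLaw.Theorems.ExtensiveSnapshotIrreversibility.TapDuality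

variable {N : ℕ}

/-- The bond currents are odd under the momentum flip `Θ(q,p) = (q,−p)`. [folklore] -/
theorem bondCurrent_flip (Q : OscillatorChain) (i : Fin N) (x : PhaseSpace N) :
    Q.bondCurrent N i (x.1, -x.2) = -Q.bondCurrent N i x := by
  unfold OscillatorChain.bondCurrent
  rw [← Finset.sum_neg_distrib]
  refine Finset.sum_congr rfl fun j _ => ?_
  split_ifs
  · simp only [Pi.neg_apply]; ring
  · simp

section Pinned

variable {ω₂ lam β γ : ℝ} (hω : 0 < ω₂) (hl : 0 < lam) (hβ : 0 < β) (hγ : 0 < γ) {T : ℝ} (hT : 0 < T)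
  (hN : 0 < N)
include hω hl hβ hγ hT hN

/-- Forecasts of a single bond current decay exponentially and are continuous in time; hence the
forecast integral `∫₀^∞ P_s j_i(z) ds` converges absolutely, and is the limit of the finite-horizon
integrals. [cite: CuneoEckmannHairerReyBellet2018, Thm 2.13 eq. (2.5)] -/
theorem integrableOn_forecast_bondCurrent (i : Fin N) (z : PhaseSpace N) :
    IntegrableOn (fun s : ℝ => ∫ y, (pinnedChain ω₂ lam β γ).bondCurrent N i y
      ∂((pinnedChain ω₂ lam β γ).transitionKernel N T T s.toNNReal z)) (Ioi 0) := by
  set P := pinnedChain ω₂ lam β γ with hP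
  have hϑ : (0 : ℝ) < 1 / (4 * T) := by positivity
  have hϑT : 1 / (4 * T) < 1 / T := by
    rw [div_lt_div_iff₀ (by positivity) hT]; nlinarith
  have h2ϑ : 2 * (1 / (4 * T)) < 1 / T := by
    rw [show 2 * (1 / (4 * T)) = 1 / (2 * T) by field_simp; ring, div_lt_div_iff₀ (by positivity) hT]
    nlinarith
  obtain ⟨K, hK⟩ := pinnedChain_abs_bondCurrent_le_exp hω hl.le hβ.le γ N hϑ i
  have hK0 : 0 ≤ K := by
    have h := hK ((0 : Fin N → ℝ), (0 : Fin N → ℝ))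
    have h1 : 0 < Real.exp (1 / (4 * T) * P.hamiltonian N ((0 : Fin N → ℝ), (0 : Fin N → ℝ))) :=
      Real.exp_pos _
    nlinarith [abs_nonneg (P.bondCurrent N i ((0 : Fin N → ℝ), (0 : Fin N → ℝ)))]
  have hjc : Continuous (P.bondCurrent N i) := LinearResponseFTUR.continuous_bondCurrent_pinned (N := N) (i := i) ω₂ lam β γ
  obtain ⟨M, c, hM, hc, hdec⟩ := forecast_decay_of_odd hω hl hβ hγ hT hN hϑ hϑT hK0 hjc
    (fun x => bondCurrent_flip P i x) hK
  obtain ⟨hcont, -, -, -, -⟩ := ClausiusBudget.pinnedChain_actWindowKinetics ω₂ lam β γ hω hl.le hβ hγ N hN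
    T hT (1 / (4 * T)) K hϑ h2ϑ hK0 (P.bondCurrent N i) hjc hK _ rfl _ rfl
  refine ⟨(hcont z).aestronglyMeasurable.restrict, ?_⟩
  have hbound : ∀ᵐ s ∂(volume.restrict (Ioi (0 : ℝ))), ‖∫ y, P.bondCurrent N i y
      ∂(P.transitionKernel N T T s.toNNReal z)‖ ≤
      M * Real.exp (1 / (4 * T) * P.hamiltonian N z) * Real.exp (-c * s) := by
    filter_upwards [ae_restrict_mem measurableSet_Ioi] with s hs
    rw [Real.norm_eq_abs]
    have h := hdec s.toNNReal z
    rwa [Real.coe_toNNReal _ (le_of_lt hs)] at h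
  refine HasFiniteIntegral.mono' ?_ hbound
  exact ((exp_neg_integrableOn_Ioi 0 hc).const_mul _).hasFiniteIntegral

/-- **The transport forecasts of consecutive bonds differ by the site energy between them.** For three
consecutive sites `a, b, c` and every `z`:
`∫₀^∞ P_s j_a(z) ds − ∫₀^∞ P_s j_b(z) ds = μ_T(ẽ_b) − ẽ_b(z)`,
`ẽ_b = p_b²/2 + U(q_b) + ½V(q_c − q_b) + ½V(q_b − q_a)` (Dynkin for `ẽ_b`, `Lẽ_b = j_a − j_b`; mixing).
[cite: CuneoEckmannHairerReyBellet2018, §3 eq. (3.2)–(3.4) and Thm 2.13 eq. (2.5)] -/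
theorem forecastIntegral_bondCurrent_sub_eq {a b c : Fin N} (hab : b.val = a.val + 1)
    (hbc : c.val = b.val + 1) (z : PhaseSpace N) :
    (∫ s in Ioi (0 : ℝ), ∫ y, (pinnedChain ω₂ lam β γ).bondCurrent N a y
        ∂((pinnedChain ω₂ lam β γ).transitionKernel N T T s.toNNReal z)) -
      (∫ s in Ioi (0 : ℝ), ∫ y, (pinnedChain ω₂ lam β γ).bondCurrent N b y
        ∂((pinnedChain ω₂ lam β γ).transitionKernel N T T s.toNNReal z)) =
      (∫ y, ((y.2 b) ^ 2 / 2 + (pinnedChain ω₂ lam β γ).U (y.1 b) +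
          (pinnedChain ω₂ lam β γ).V (y.1 c - y.1 b) / 2 + (pinnedChain ω₂ lam β γ).V (y.1 b - y.1 a) / 2)
        ∂((pinnedChain ω₂ lam β γ).gibbsMeasure N T)) -
      ((z.2 b) ^ 2 / 2 + (pinnedChain ω₂ lam β γ).U (z.1 b) +
          (pinnedChain ω₂ lam β γ).V (z.1 c - z.1 b) / 2 + (pinnedChain ω₂ lam β γ).V (z.1 b - z.1 a) / 2) := by
  set P := pinnedChain ω₂ lam β γ with hP
  set κ : ℝ → Measure (PhaseSpace N) := fun s => P.transitionKernel N T T s.toNNReal z with hκ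
  set Fa : ℝ → ℝ := fun s => ∫ y, P.bondCurrent N a y ∂(κ s) with hFa
  set Fb : ℝ → ℝ := fun s => ∫ y, P.bondCurrent N b y ∂(κ s) with hFb
  set e : PhaseSpace N → ℝ := fun y => (y.2 b) ^ 2 / 2 + P.U (y.1 b) + P.V (y.1 c - y.1 b) / 2 +
    P.V (y.1 b - y.1 a) / 2 with he
  -- integrability of the two forecasts on `(0, ∞)`
  have hIa : IntegrableOn Fa (Ioi 0) := integrableOn_forecast_bondCurrent hω hl hβ hγ hT hN a z
  have hIb : IntegrableOn Fb (Ioi 0) := integrableOn_forecast_bondCurrent hω hl hβ hγ hT hN b z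
  -- the improper integral is the limit of the finite-horizon ones
  have hlim : Tendsto (fun r : ℝ => ∫ s in (0 : ℝ)..r, (Fa s - Fb s)) atTop
      (𝓝 (∫ s in Ioi (0 : ℝ), (Fa s - Fb s))) :=
    intervalIntegral_tendsto_integral_Ioi 0 (hIa.sub hIb) tendsto_id
  rw [← integral_sub hIa hIb]
  -- the finite-horizon integrals are `P_r ẽ_b(z) − ẽ_b(z)` (Dynkin)
  have hϑ : (0 : ℝ) < 1 / (4 * T) := by positivity
  have hϑT : 1 / (4 * T) < 1 / T := by
    rw [div_lt_div_iff₀ (by positivity) hT]; nlinarith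
  obtain ⟨Ka, hKa⟩ := pinnedChain_abs_bondCurrent_le_exp hω hl.le hβ.le γ N hϑ a
  obtain ⟨Kb, hKb⟩ := pinnedChain_abs_bondCurrent_le_exp hω hl.le hβ.le γ N hϑ b
  have hjac : Continuous (P.bondCurrent N a) := LinearResponseFTUR.continuous_bondCurrent_pinned (N := N) (i := a) ω₂ lam β γ
  have hjbc : Continuous (P.bondCurrent N b) := LinearResponseFTUR.continuous_bondCurrent_pinned (N := N) (i := b) ω₂ lam β γ
  have hint : ∀ s : ℝ, Integrable (fun y => Real.exp (1 / (4 * T) * P.hamiltonian N y)) (κ s) := fun s =>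
    pinnedChain_integrable_exp_mul_hamiltonian_transitionKernel hω hl.le hT hβ.le hγ.le hN hϑ hϑT _ z
  have hja : ∀ s, Integrable (P.bondCurrent N a) (κ s) := fun s =>
    integrable_of_abs_le_exp (hint s) hjac hKa
  have hjb : ∀ s, Integrable (P.bondCurrent N b) (κ s) := fun s =>
    integrable_of_abs_le_exp (hint s) hjbc hKb
  have hdyn : ∀ r : ℝ, 0 ≤ r → ∫ s in (0 : ℝ)..r, (Fa s - Fb s) = (∫ y, e y ∂(κ r)) - e z := by
    intro r hr
    have h := NonBallistic.pinnedChain_splitSiteEnergy_dynkin hω hl.le hβ hγ (N := N) (T := T) hT hab hbc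
      r.toNNReal z
    have hsub : ∀ s, Fa s - Fb s = ∫ y, (P.bondCurrent N a y - P.bondCurrent N b y) ∂(κ s) := fun s => by
      rw [integral_sub (hja s) (hjb s)]
    simp_rw [hsub]
    rw [hκ]
    simp only at h ⊢
    rw [Real.coe_toNNReal _ hr] at h
    rw [h]
  -- mixing: `P_r ẽ_b(z) → μ_T(ẽ_b)`
  have hec : Continuous e := NonBallistic.pinnedChain_continuous_splitSiteEnergy ω₂ lam β γ a b c
  have he02 : ∀ y, 0 ≤ e y ∧ e y ≤ 2 * P.hamiltonian N y := fun y =>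
    NonBallistic.pinnedChain_splitSiteEnergy_nonneg_le hω.le hl.le hβ.le γ hab hbc y
  have heb : ∀ y, |(1 / (8 * T)) * e y| ≤ Real.exp (1 / (4 * T) * P.hamiltonian N y) := fun y => by
    obtain ⟨h0, h2⟩ := he02 y
    rw [abs_of_nonneg (by positivity)]
    calc 1 / (8 * T) * e y ≤ 1 / (8 * T) * (2 * P.hamiltonian N y) :=
          mul_le_mul_of_nonneg_left h2 (by positivity)
      _ = 1 / (4 * T) * P.hamiltonian N y := by field_simp; ring
      _ ≤ Real.exp (1 / (4 * T) * P.hamiltonian N y) := by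
          have := Real.add_one_le_exp (1 / (4 * T) * P.hamiltonian N y); linarith
  obtain ⟨C, c', hC, hc', hmix⟩ := pinnedChain_exp_convergence_gibbs hω hl.le hβ hγ hN hT hϑ hϑT
  have h8T : (0 : ℝ) < 1 / (8 * T) := by positivity
  have hmixe : ∀ t : ℝ≥0, |(∫ y, e y ∂(P.transitionKernel N T T t z)) - ∫ y, e y ∂(P.gibbsMeasure N T)| ≤
      (8 * T) * (C * Real.exp (1 / (4 * T) * P.hamiltonian N z)) * Real.exp (-c' * t) := by
    intro t
    have h := hmix z t (fun y => (1 / (8 * T)) * e y) (continuous_const.mul hec) heb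
    rw [integral_const_mul, integral_const_mul, ← mul_sub, abs_mul, abs_of_pos h8T] at h
    have h8T' : (0 : ℝ) < 8 * T := by positivity
    calc |(∫ y, e y ∂(P.transitionKernel N T T t z)) - ∫ y, e y ∂(P.gibbsMeasure N T)|
        = (8 * T) * (1 / (8 * T) * |(∫ y, e y ∂(P.transitionKernel N T T t z)) -
            ∫ y, e y ∂(P.gibbsMeasure N T)|) := by field_simp
      _ ≤ (8 * T) * (C * Real.exp (1 / (4 * T) * P.hamiltonian N z) * Real.exp (-c' * t)) :=
          mul_le_mul_of_nonneg_left h h8T'.le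
      _ = (8 * T) * (C * Real.exp (1 / (4 * T) * P.hamiltonian N z)) * Real.exp (-c' * t) := by ring
  have hlim2 : Tendsto (fun r : ℝ => (∫ y, e y ∂(κ r)) - e z) atTop
      (𝓝 ((∫ y, e y ∂(P.gibbsMeasure N T)) - e z)) := by
    refine Tendsto.sub_const ?_ _
    rw [Metric.tendsto_atTop]
    intro ε hε
    set A : ℝ := (8 * T) * (C * Real.exp (1 / (4 * T) * P.hamiltonian N z)) with hA
    have hA0 : 0 < A := by positivity
    -- choose `r₀` with `A e^{-c' r₀} < ε`
    obtain ⟨r₀, hr₀⟩ : ∃ r₀ : ℝ, ∀ r ≥ r₀, A * Real.exp (-c' * r) < ε := by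
      have ht : Tendsto (fun r : ℝ => A * Real.exp (-c' * r)) atTop (𝓝 0) := by
        have := (Real.tendsto_exp_neg_atTop_nhds_zero.comp (tendsto_id.const_mul_atTop hc'))
        simpa [neg_mul] using this.const_mul A
      have hev := (ht.eventually (gt_mem_nhds hε))
      obtain ⟨r₀, hr₀⟩ := Filter.eventually_atTop.mp hev
      exact ⟨r₀, hr₀⟩
    refine ⟨max r₀ 0, fun r hr => ?_⟩
    have hr0 : 0 ≤ r := le_trans (le_max_right _ _) hr
    have hrr : r₀ ≤ r := le_trans (le_max_left _ _) hr
    rw [Real.dist_eq]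
    have h := hmixe r.toNNReal
    rw [Real.coe_toNNReal _ hr0] at h
    exact lt_of_le_of_lt h (hr₀ r hrr)
  -- the two limits agree
  have heq : (fun r : ℝ => ∫ s in (0 : ℝ)..r, (Fa s - Fb s)) =ᶠ[atTop] fun r => (∫ y, e y ∂(κ r)) - e z := by
    filter_upwards [Filter.eventually_ge_atTop (0 : ℝ)] with r hr using hdyn r hr
  exact tendsto_nhds_unique (hlim.congr' heq) hlim2

/-- **The odd transport forecast is bond-independent.** For three consecutive sites `a, b, c`, the
forecast integrals `F_i(z) = ∫₀^∞ P_s j_i(z) ds` of the bonds `a` and `b` have the same odd part under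
the momentum flip: `F_a(z) − F_a(Θz) = F_b(z) − F_b(Θz)` for every `z`.  Consequently the odd Kubo
corrector of the total current is `(N−1)` times the odd forecast of any single interior bond.
[cite: CuneoEckmannHairerReyBellet2018, §3 eq. (3.2)–(3.4) and Thm 2.13 eq. (2.5)] -/
theorem oddPart_forecastIntegral_bondCurrent_eq {a b c : Fin N} (hab : b.val = a.val + 1)
    (hbc : c.val = b.val + 1) (z : PhaseSpace N) :
    (∫ s in Ioi (0 : ℝ), ∫ y, (pinnedChain ω₂ lam β γ).bondCurrent N a y
        ∂((pinnedChain ω₂ lam β γ).transitionKernel N T T s.toNNReal z)) -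
      (∫ s in Ioi (0 : ℝ), ∫ y, (pinnedChain ω₂ lam β γ).bondCurrent N a y
        ∂((pinnedChain ω₂ lam β γ).transitionKernel N T T s.toNNReal (z.1, -z.2))) =
    (∫ s in Ioi (0 : ℝ), ∫ y, (pinnedChain ω₂ lam β γ).bondCurrent N b y
        ∂((pinnedChain ω₂ lam β γ).transitionKernel N T T s.toNNReal z)) -
      (∫ s in Ioi (0 : ℝ), ∫ y, (pinnedChain ω₂ lam β γ).bondCurrent N b y
        ∂((pinnedChain ω₂ lam β γ).transitionKernel N T T s.toNNReal (z.1, -z.2))) := by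
  have h1 := forecastIntegral_bondCurrent_sub_eq hω hl hβ hγ hT hN hab hbc z
  have h2 := forecastIntegral_bondCurrent_sub_eq hω hl hβ hγ hT hN hab hbc (z.1, -z.2)
  simp only [Pi.neg_apply, even_two.neg_pow] at h2
  linarith

end Pinned

/-- **Registered helper stub `helper_oddForecastBondIndependence`** (closed form of
`oddPart_forecastIntegral_bondCurrent_eq`). [cite: CuneoEckmannHairerReyBellet2018, Thm 2.13 eq. (2.5)] -/
theorem helper_oddForecastBondIndependence :
    ∀ ω₂ lam β γ : ℝ, 0 < ω₂ → 0 < lam → 0 < β → 0 < γ → ∀ T : ℝ, 0 < T → ∀ (N : ℕ), 0 < N →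
      ∀ (a b c : Fin N), b.val = a.val + 1 → c.val = b.val + 1 → ∀ z : PhaseSpace N,
        (∫ s in Set.Ioi (0 : ℝ), ∫ y, (pinnedChain ω₂ lam β γ).bondCurrent N a y
            ∂((pinnedChain ω₂ lam β γ).transitionKernel N T T s.toNNReal z)) -
          (∫ s in Set.Ioi (0 : ℝ), ∫ y, (pinnedChain ω₂ lam β γ).bondCurrent N a y
            ∂((pinnedChain ω₂ lam β γ).transitionKernel N T T s.toNNReal (z.1, -z.2))) =
        (∫ s in Set.Ioi (0 : ℝ), ∫ y, (pinnedChain ω₂ lam β γ).bondCurrent N b y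
            ∂((pinnedChain ω₂ lam β γ).transitionKernel N T T s.toNNReal z)) -
          (∫ s in Set.Ioi (0 : ℝ), ∫ y, (pinnedChain ω₂ lam β γ).bondCurrent N b y
            ∂((pinnedChain ω₂ lam β γ).transitionKernel N T T s.toNNReal (z.1, -z.2))) :=
  fun _ _ _ _ hω hl hβ hγ _ hT _ hN _ _ _ hab hbc z =>
    oddPart_forecastIntegral_bondCurrent_eq hω hl hβ hγ hT hN hab hbc z

section Chain

variable {ω₂ lam β γ : ℝ} (hω : 0 < ω₂) (hl : 0 < lam) (hβ : 0 < β) (hγ : 0 < γ) {T : ℝ} (hT : 0 < T)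
  (hN : 0 < N)
include hω hl hβ hγ hT hN

/-- **All interior bonds carry the same odd transport forecast.** For bonds `i ≤ k` with `k + 1 < N`:
`F_i(z) − F_i(Θz) = F_k(z) − F_k(Θz)`, `F_i(z) = ∫₀^∞ P_s j_i(z) ds` (chaining the consecutive case).
[cite: CuneoEckmannHairerReyBellet2018, Thm 2.13 eq. (2.5)] -/
theorem oddPart_forecastIntegral_bondCurrent_eq_of_le {i k : Fin N} (hik : i ≤ k) (hk : k.val + 1 < N)
    (z : PhaseSpace N) :
    (∫ s in Ioi (0 : ℝ), ∫ y, (pinnedChain ω₂ lam β γ).bondCurrent N i y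
        ∂((pinnedChain ω₂ lam β γ).transitionKernel N T T s.toNNReal z)) -
      (∫ s in Ioi (0 : ℝ), ∫ y, (pinnedChain ω₂ lam β γ).bondCurrent N i y
        ∂((pinnedChain ω₂ lam β γ).transitionKernel N T T s.toNNReal (z.1, -z.2))) =
    (∫ s in Ioi (0 : ℝ), ∫ y, (pinnedChain ω₂ lam β γ).bondCurrent N k y
        ∂((pinnedChain ω₂ lam β γ).transitionKernel N T T s.toNNReal z)) -
      (∫ s in Ioi (0 : ℝ), ∫ y, (pinnedChain ω₂ lam β γ).bondCurrent N k y
        ∂((pinnedChain ω₂ lam β γ).transitionKernel N T T s.toNNReal (z.1, -z.2))) := by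
  -- induction on the distance `k - i`
  suffices H : ∀ n : ℕ, ∀ i k : Fin N, k.val = i.val + n → k.val + 1 < N →
      (∫ s in Ioi (0 : ℝ), ∫ y, (pinnedChain ω₂ lam β γ).bondCurrent N i y
          ∂((pinnedChain ω₂ lam β γ).transitionKernel N T T s.toNNReal z)) -
        (∫ s in Ioi (0 : ℝ), ∫ y, (pinnedChain ω₂ lam β γ).bondCurrent N i y
          ∂((pinnedChain ω₂ lam β γ).transitionKernel N T T s.toNNReal (z.1, -z.2))) =
      (∫ s in Ioi (0 : ℝ), ∫ y, (pinnedChain ω₂ lam β γ).bondCurrent N k y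
          ∂((pinnedChain ω₂ lam β γ).transitionKernel N T T s.toNNReal z)) -
        (∫ s in Ioi (0 : ℝ), ∫ y, (pinnedChain ω₂ lam β γ).bondCurrent N k y
          ∂((pinnedChain ω₂ lam β γ).transitionKernel N T T s.toNNReal (z.1, -z.2))) by
    exact H (k.val - i.val) i k (by have := hik; omega) hk
  intro n
  induction n with
  | zero =>
      intro i k hki _
      have : k = i := Fin.ext (by omega)
      subst this; rfl
  | succ n ih =>
      intro i k hki hk
      set m : Fin N := ⟨i.val + n, by omega⟩ with hm
      have h1 := ih i m (by simp [hm]) (by simp [hm]; omega)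
      have hmk : k.val = m.val + 1 := by simp [hm]; omega
      set c : Fin N := ⟨k.val + 1, hk⟩ with hc
      have hkc : c.val = k.val + 1 := by simp [hc]
      have h2 := oddPart_forecastIntegral_bondCurrent_eq hω hl hβ hγ hT hN hmk hkc z
      rw [h1, h2]

/-- **The odd Kubo forecast of the total current is `(N − 1)` copies of one bond's odd forecast.** For
`N ≥ 2`, the forecast integral of the total current `J = ∑_i j_i`, `u⋆(z) = ∫₀^∞ P_s J(z) ds` (the pointwise
Kubo corrector of `Corrector.corrector_exists`), satisfies
`u⋆(z) − u⋆(Θz) = (N − 1)·(F_0(z) − F_0(Θz))` with `F_0(z) = ∫₀^∞ P_s j_0(z) ds` the forecast of the contact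
bond: the odd corrector `uo = (u⋆ − u⋆∘Θ)/2` equals `(N−1)` times the odd forecast of a single bond, so the
crux's `N`-uniform content `∫ uo² dμ_T ≤ C·N³` is the single-bond statement `∫ (F_0 − F_0∘Θ)² dμ_T ≤ 4C·N`.
[cite: CuneoEckmannHairerReyBellet2018, Thm 2.13 eq. (2.5)] -/
theorem oddPart_kuboForecast_eq_card_mul (hN2 : 2 ≤ N) (z : PhaseSpace N) :
    (∫ s in Ioi (0 : ℝ), ∫ y, (∑ i : Fin N, (pinnedChain ω₂ lam β γ).bondCurrent N i y)
        ∂((pinnedChain ω₂ lam β γ).transitionKernel N T T s.toNNReal z)) -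
      (∫ s in Ioi (0 : ℝ), ∫ y, (∑ i : Fin N, (pinnedChain ω₂ lam β γ).bondCurrent N i y)
        ∂((pinnedChain ω₂ lam β γ).transitionKernel N T T s.toNNReal (z.1, -z.2))) =
    ((N : ℝ) - 1) *
      ((∫ s in Ioi (0 : ℝ), ∫ y, (pinnedChain ω₂ lam β γ).bondCurrent N ⟨0, hN⟩ y
          ∂((pinnedChain ω₂ lam β γ).transitionKernel N T T s.toNNReal z)) -
        (∫ s in Ioi (0 : ℝ), ∫ y, (pinnedChain ω₂ lam β γ).bondCurrent N ⟨0, hN⟩ y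
          ∂((pinnedChain ω₂ lam β γ).transitionKernel N T T s.toNNReal (z.1, -z.2)))) := by
  set P := pinnedChain ω₂ lam β γ with hP
  -- integrability of each bond current against the kernels, and of each forecast in time
  have hϑ : (0 : ℝ) < 1 / (4 * T) := by positivity
  have hϑT : 1 / (4 * T) < 1 / T := by
    rw [div_lt_div_iff₀ (by positivity) hT]; nlinarith
  have hjκ : ∀ (i : Fin N) (s : ℝ) (x : PhaseSpace N), Integrable (P.bondCurrent N i)
      (P.transitionKernel N T T s.toNNReal x) := by
    intro i s x
    obtain ⟨K, hK⟩ := pinnedChain_abs_bondCurrent_le_exp hω hl.le hβ.le γ N hϑ i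
    exact integrable_of_abs_le_exp
      (pinnedChain_integrable_exp_mul_hamiltonian_transitionKernel hω hl.le hT hβ.le hγ.le hN hϑ hϑT _ x)
      (LinearResponseFTUR.continuous_bondCurrent_pinned (N := N) (i := i) ω₂ lam β γ) hK
  -- linearity: the forecast of the sum is the sum of the forecasts (both `z` and `Θz`)
  have hlin : ∀ x : PhaseSpace N,
      (∫ s in Ioi (0 : ℝ), ∫ y, (∑ i : Fin N, P.bondCurrent N i y) ∂(P.transitionKernel N T T s.toNNReal x)) =
        ∑ i : Fin N, ∫ s in Ioi (0 : ℝ), ∫ y, P.bondCurrent N i y ∂(P.transitionKernel N T T s.toNNReal x) := by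
    intro x
    have hin : ∀ s : ℝ, (∫ y, (∑ i : Fin N, P.bondCurrent N i y) ∂(P.transitionKernel N T T s.toNNReal x)) =
        ∑ i : Fin N, ∫ y, P.bondCurrent N i y ∂(P.transitionKernel N T T s.toNNReal x) := fun s =>
      integral_finsetSum _ fun i _ => hjκ i s x
    simp_rw [hin]
    exact integral_finsetSum _ fun i _ => integrableOn_forecast_bondCurrent hω hl hβ hγ hT hN i x
  rw [hlin z, hlin (z.1, -z.2), ← Finset.sum_sub_distrib]
  -- every interior bond contributes the contact bond's odd forecast; the last site carries no bond
  obtain ⟨n, rfl⟩ : ∃ n, N = n + 1 := ⟨N - 1, by omega⟩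
  rw [Fin.sum_univ_castSucc]
  have hlast : ∀ x : PhaseSpace (n + 1), (∫ s in Ioi (0 : ℝ), ∫ y, P.bondCurrent (n + 1) (Fin.last n) y
      ∂(P.transitionKernel (n + 1) T T s.toNNReal x)) = 0 := by
    intro x
    have h0 : ∀ y, P.bondCurrent (n + 1) (Fin.last n) y = 0 := fun y => by
      unfold OscillatorChain.bondCurrent
      refine Finset.sum_eq_zero fun j _ => ?_
      have hj := j.isLt
      rw [if_neg (by simp only [Fin.val_last]; omega)]
    simp_rw [h0, integral_zero]
  rw [hlast z, hlast (z.1, -z.2), sub_zero, add_zero]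
  have hterm : ∀ i : Fin n,
      (∫ s in Ioi (0 : ℝ), ∫ y, P.bondCurrent (n + 1) (Fin.castSucc i) y
          ∂(P.transitionKernel (n + 1) T T s.toNNReal z)) -
        (∫ s in Ioi (0 : ℝ), ∫ y, P.bondCurrent (n + 1) (Fin.castSucc i) y
          ∂(P.transitionKernel (n + 1) T T s.toNNReal (z.1, -z.2))) =
      (∫ s in Ioi (0 : ℝ), ∫ y, P.bondCurrent (n + 1) ⟨0, hN⟩ y
          ∂(P.transitionKernel (n + 1) T T s.toNNReal z)) -
        (∫ s in Ioi (0 : ℝ), ∫ y, P.bondCurrent (n + 1) ⟨0, hN⟩ y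
          ∂(P.transitionKernel (n + 1) T T s.toNNReal (z.1, -z.2))) := by
    intro i
    exact (oddPart_forecastIntegral_bondCurrent_eq_of_le hω hl hβ hγ hT hN (i := ⟨0, hN⟩)
      (k := Fin.castSucc i) (Fin.le_def.mpr (Nat.zero_le _)) (Nat.succ_lt_succ i.is_lt) z).symm
  rw [Finset.sum_congr rfl fun i _ => hterm i, Finset.sum_const, Finset.card_univ, Fintype.card_fin,
    nsmul_eq_mul]
  push_cast
  ring

end Chain

/-- **Registered helper stub `helper_oddKuboForecastCardMul`** (closed form of
`oddPart_kuboForecast_eq_card_mul`). [cite: CuneoEckmannHairerReyBellet2018, Thm 2.13 eq. (2.5)] -/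
theorem helper_oddKuboForecastCardMul :
    ∀ ω₂ lam β γ : ℝ, 0 < ω₂ → 0 < lam → 0 < β → 0 < γ → ∀ T : ℝ, 0 < T → ∀ (N : ℕ) (hN : 0 < N), 2 ≤ N →
      ∀ z : PhaseSpace N,
        (∫ s in Set.Ioi (0 : ℝ), ∫ y, (∑ i : Fin N, (pinnedChain ω₂ lam β γ).bondCurrent N i y)
            ∂((pinnedChain ω₂ lam β γ).transitionKernel N T T s.toNNReal z)) -
          (∫ s in Set.Ioi (0 : ℝ), ∫ y, (∑ i : Fin N, (pinnedChain ω₂ lam β γ).bondCurrent N i y)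
            ∂((pinnedChain ω₂ lam β γ).transitionKernel N T T s.toNNReal (z.1, -z.2))) =
        ((N : ℝ) - 1) *
          ((∫ s in Set.Ioi (0 : ℝ), ∫ y, (pinnedChain ω₂ lam β γ).bondCurrent N ⟨0, hN⟩ y
              ∂((pinnedChain ω₂ lam β γ).transitionKernel N T T s.toNNReal z)) -
            (∫ s in Set.Ioi (0 : ℝ), ∫ y, (pinnedChain ω₂ lam β γ).bondCurrent N ⟨0, hN⟩ y
              ∂((pinnedChain ω₂ lam β γ).transitionKernel N T T s.toNNReal (z.1, -z.2)))) :=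
  fun _ _ _ _ hω hl hβ hγ _ hT _ hN hN2 z =>
    oddPart_kuboForecast_eq_card_mul hω hl hβ hγ hT hN hN2 z

end Summit.AtomisticToContinuum.FouriersLaw.Theorems.ExtensiveSnapshotIrreversibility.TapDuality

end
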